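import Summits.CriticalPhenomena.Ising3DConformalLimit.Theorems.IsingEuclidUpgradeR4NonGaussianSecondMomentBox
import Summits.CriticalPhenomena.Ising3DConformalLimit.Theorems.IsingEuclidUpgradeR4NonGaussianMomentRatioLowerBound
import Literature.Probability.LatticeModels.CriticalUrsellFourSign
import Literature.Probability.LatticeModels.SusceptibilityMeanFieldBound
import HarnessLib

/-!
# Crux `IsingEuclidUpgradeR4NonGaussian` (stmt-CriticalPhenomena-0636), line `free-covariance-delta-dichotomy`:
# the FAT STEP is a theorem, and the thin step (meeting robustness) is EXACTLY the crux's conclusion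

Finite volume throughout (free box `Λ_L ⊂ ℤ³` at `β_c(3)`, vocabulary of the landed Defs file
`IsingEuclidUpgradeR4NonGaussianDefs`: `lat`, `boxG`, `twoCurrentMeet` = `P²`, `fourCurrentMeet` = `P⁴`,
`boxMoment₁`, `boxMoment₂`, `latU4`, `ScaleCovariantOn`).

* `stub_fatStep` (registered sub-goal of the crux): for every non-degenerate pointwise scaling limit
  `S` of `criticalCorr 3` (`ρ > 0` on `(0,1]`) that is scale covariant on non-coincident configurations
  with exponent `Δ < 3/4`, and EVERY non-coincident quadruple `x`, the four-current gluing probability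
  `P⁴ = P^{x̃₀x̃₁,∅} ⊗ P^{x̃₂x̃₃,∅}[x̃₀ ↔ x̃₂ in n₁+n₃+n₂+n₄]` at `x̃ = [x/δ]` is `≥ c(x) > 0` for all
  small `δ` and then all large `L` — Aizenman–Duminil-Copin's second-moment method (Lemma 4.4) run in
  `d = 3` below the marginal exponent: `stub_secondMomentBox` (P⁴ ≥ M₁²/M₂, landed) ∘
  `stub_momentRatioLowerBound` (M₁²/M₂ ≥ c, landed; the only place `3 − 4Δ > 0` enters).
* `fourCurrentMeet_le_one` (`P⁴ ≤ 1`).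
* `meetingRobustness_iff_hasNontrivialU4`: under the same hypotheses, the line's open heart
  MEETING ROBUSTNESS at `(ρ,S)` — `∃ x ∈ NC₄, ∃ c > 0, ∀ᶠ δ, ∀ᶠ L, c·P⁴ ≤ P²` — is EQUIVALENT to
  `HasNontrivialU4 S`, i.e. to the crux's own conclusion for that limit. (⇒: fat step, the PROVED box
  identity `U₄,Λ = −2⟨σσ⟩⟨σσ⟩·P²` (`connectedFour_free_box_eq`), box → infinite volume, lattice → limit;
  ⇐: `U₄^S(x) < 0` at some `x` (`hasNontrivialU4_iff_exists_neg_of_hasPointwiseScalingLimit`) forces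
  `P² ≥ κ > 0` at `[x/δ]`, and `P⁴ ≤ 1`.) So, with the fat step discharged, the thin step carries exactly
  the crux below `Δ = 3/4` — the calibration announced in the line card, now kernel-checked.

References: M. Aizenman, H. Duminil-Copin, Ann. Math. 194 (2021) = arXiv:1912.07973, §3 (3.11)–(3.13),
§4.2 Lemma 4.4; M. Aizenman, Comm. Math. Phys. 86 (1982) §1, §5.
-/

noncomputable section

open Filter Topology Set Function MeasureTheory Finset
open Literature.Probability.LatticeModels Literature.Probability.Percolation
open scoped symmDiff

namespace Summit.CriticalPhenomena.Ising3DConformalLimit.Cruxes.IsingEuclidUpgradeR4NonGaussian.FreeCovarianceDeltaDichotomy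

/-! ## The fat step -/

/-- Eventually (in `L`) the four lattice points and a given finite set lie in the box `Λ_L`. [folklore] -/
theorem eventually_lat_mem_box (δ : ℝ) (x : Fin 4 → EuclideanSpace ℝ (Fin 3)) (A : Finset (Site 3)) :
    ∀ᶠ L : ℕ in atTop, (∀ i, lat δ x i ∈ box 3 L) ∧ A ⊆ box 3 L := by
  classical
  obtain ⟨L₀, hL₀⟩ := exists_forall_subset_box 3 (A ∪ Finset.univ.image (lat δ x))
  filter_upwards [eventually_ge_atTop L₀] with L hL
  refine ⟨fun i => hL₀ L hL ?_, fun v hv => hL₀ L hL (Finset.mem_union_left _ hv)⟩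
  exact Finset.mem_union_right _ (Finset.mem_image_of_mem _ (Finset.mem_univ i))

/-- **Registered sub-goal `stub_fatStep` — THE FAT STEP (Aizenman–Duminil-Copin's second-moment method in
`d = 3` below the marginal exponent):** for a non-degenerate pointwise scaling limit of `criticalCorr 3`
(`ρ > 0` on `(0,1]`), scale covariant on non-coincident configurations with exponent `Δ < 3/4`, the
four-current gluing probability `P⁴` at `[x/δ]` is bounded below, for small `δ` and then large `L`, at
EVERY non-coincident quadruple `x`. [cite: AizenmanDuminilCopinAnnals2021, §4.2 Lemma 4.4] -/
theorem stub_fatStep :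
    ∀ (ρ : ℝ → ℝ) (S : CorrFamily 3) (Δ : ℝ), (∀ δ ∈ Set.Ioc (0:ℝ) 1, 0 < ρ δ) →
      HasPointwiseScalingLimit (criticalCorr 3) ρ S → IsNondegenerateTwoPoint S →
      ScaleCovariantOn Δ S → Δ < 3 / 4 →
      ∀ x ∈ NonCoincident 3 4, ∃ c : ℝ, 0 < c ∧ ∀ᶠ δ in 𝓝[>] (0:ℝ), ∀ᶠ L : ℕ in atTop,
        c ≤ fourCurrentMeet L (lat δ x 0) (lat δ x 1) (lat δ x 2) (lat δ x 3) := by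
  intro ρ S Δ hρ hlim hnd hcov hΔ x hx
  obtain ⟨c, hc, A, hev⟩ := stub_momentRatioLowerBound ρ S Δ hρ hlim hnd hcov hΔ x hx
  refine ⟨c, hc, ?_⟩
  filter_upwards [hev] with δ hδ
  filter_upwards [hδ, eventually_lat_mem_box δ x (A δ)] with L hL hbox
  exact hL.trans (stub_secondMomentBox L _ _ _ _ (hbox.1 0) (hbox.1 1) (hbox.1 2) (hbox.1 3)
    (A δ) hbox.2)

/-- A double-current measure with `β ≥ 0` is either the zero measure (no admissible currents) or a
probability measure. [cite: DuminilCopin2016, §2.2] -/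
theorem doubleCurrentMeasure_zero_or_prob {V : Type*} [Fintype V] [DecidableEq V] (G : SimpleGraph V)
    [DecidableRel G.Adj] {β : ℝ} (hβ : 0 ≤ β) (A B : Finset V) :
    doubleCurrentMeasure G β A B = 0 ∨ IsProbabilityMeasure (doubleCurrentMeasure G β A B) := by
  by_cases h : currentSum G β A ≠ 0 ∧ currentSum G β B ≠ 0
  · exact Or.inr (isProbabilityMeasure_doubleCurrentMeasure_holds G hβ h.1 h.2)
  · have h0 : currentSum G β A * currentSum G β B = 0 := mul_eq_zero.2 (by tauto)
    exact Or.inl (by simp [doubleCurrentMeasure, h0])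

/-- The product of two such measures gives every set real mass `≤ 1`. [folklore] -/
theorem prod_real_le_one_of_zero_or_prob {α γ : Type*} [MeasurableSpace α] [MeasurableSpace γ]
    {μ : Measure α} {ν : Measure γ} (hμ : μ = 0 ∨ IsProbabilityMeasure μ)
    (hν : ν = 0 ∨ IsProbabilityMeasure ν) (s : Set (α × γ)) : (μ.prod ν).real s ≤ 1 := by
  rcases hμ with hμ | hμ
  · subst hμ; simp [Measure.zero_prod]
  rcases hν with hν | hν
  · subst hν; simp [Measure.prod_zero]
  exact measureReal_le_one

/-- `P⁴ ≤ 1`: the four-current law is a product of two double-current measures, each a probability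
measure or zero. [cite: AizenmanDuminilCopinAnnals2021, §3.1] -/
theorem fourCurrentMeet_le_one (L : ℕ) (a b c e : Site 3) : fourCurrentMeet L a b c e ≤ 1 :=
  prod_real_le_one_of_zero_or_prob
    (doubleCurrentMeasure_zero_or_prob (freeBoxGraph 3 L) (criticalBeta_nonneg 3) _ _)
    (doubleCurrentMeasure_zero_or_prob (freeBoxGraph 3 L) (criticalBeta_nonneg 3) _ _) _

/-! ## From a lower bound on `P²` to `U₄^S < 0`, and back -/

/-- Box data at `y = [x/δ]`: `U₄,Λ_L → U₄^{lat}`, `⟨σσ⟩_{Λ_L} → ⟨σσ⟩_{β_c}` (free b.c.), and the box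
identity `U₄,Λ_L = -2⟨σσ⟩⟨σσ⟩·P²` for `L` large. [cite: AizenmanDuminilCopinAnnals2021, eq. (3.11)] -/
theorem box_data (δ : ℝ) (x : Fin 4 → EuclideanSpace ℝ (Fin 3)) :
    Tendsto (fun L : ℕ => connectedFour (isingMeasure (zdGraph 3) (box 3 L) (criticalBeta 3) 0 .free)
        spinAt (fun i => lat δ x i)) atTop (𝓝 (latU4 δ x)) ∧
    (∀ i j : Fin 4, Tendsto (fun L : ℕ => boxG L (lat δ x i) (lat δ x j)) atTop
        (𝓝 (criticalCorr 3 2 ![lat δ x i, lat δ x j]))) ∧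
    ∀ᶠ L : ℕ in atTop,
      connectedFour (isingMeasure (zdGraph 3) (box 3 L) (criticalBeta 3) 0 .free) spinAt
          (fun i => lat δ x i) =
        -2 * boxG L (lat δ x 0) (lat δ x 1) * boxG L (lat δ x 2) (lat δ x 3) *
          twoCurrentMeet L (lat δ x 0) (lat δ x 1) (lat δ x 2) (lat δ x 3) := by
  classical
  have hmem : (BoundaryCondition.free : BoundaryCondition (Site 3)) ∈
      ({.free, .plus, .minus} : Set (BoundaryCondition (Site 3))) := by simp
  refine ⟨tendsto_connectedFour_box_criticalBeta le_rfl _, fun i j => ?_, ?_⟩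
  · have h := criticalCorr_wellDefined_holds (d := 3) le_rfl 2 ![lat δ x i, lat δ x j] .free hmem
    refine Tendsto.congr (fun L => ?_) h
    simp only [boxG, isingTwoPoint, spinMonomial_two]
  · filter_upwards [eventually_lat_mem_box δ x ∅] with L hL
    have hy4 : (fun i => lat δ x i) = ![lat δ x 0, lat δ x 1, lat δ x 2, lat δ x 3] := by
      funext i; fin_cases i <;> rfl
    rw [hy4, connectedFour_free_box_eq (d := 3) L (criticalBeta_nonneg 3) (hL.1 0) (hL.1 1) (hL.1 2)
      (hL.1 3)]
    rfl

/-- `0 < ⟨σ_aσ_b⟩_{β_c}` on `ℤ³`. [cite: DuminilCopin2019, Thm. 4.8, §4.4] -/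
theorem criticalCorr_two_pos' (a b : Site 3) : 0 < criticalCorr 3 2 ![a, b] := by
  rw [criticalCorr_two_pair]
  by_cases h : b - a = 0
  · rw [h, criticalTwoPoint_zero']
    exact one_pos
  · obtain ⟨c, C, hc, hbd⟩ := criticalTwoPoint_bounds_holds (d := 3) (by norm_num)
    have hn : 0 < (‖b - a‖ : ℝ) := norm_pos_iff.2 h
    exact lt_of_lt_of_le (mul_pos hc (Real.rpow_pos_of_pos hn _)) (hbd _ h).1

/-- **`P² ≥ κ` at `[x/δ]` ⇒ `−U₄^{lat}([x/δ]) ≥ 2κ⟨σσ⟩⟨σσ⟩` for small `δ`** (box identity, `G_L ≥ 0`,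
`Λ_L ↑ ℤ³`). [cite: AizenmanDuminilCopinAnnals2021, eq. (3.11)–(3.12)] -/
theorem lattice_ratio_of_twoCurrentMeet_lower {x : Fin 4 → EuclideanSpace ℝ (Fin 3)} {κ : ℝ}
    (hev : ∀ᶠ δ in 𝓝[>] (0:ℝ), ∀ᶠ L : ℕ in atTop,
      κ ≤ twoCurrentMeet L (lat δ x 0) (lat δ x 1) (lat δ x 2) (lat δ x 3)) :
    ∀ᶠ δ in 𝓝[>] (0:ℝ), 2 * κ * (criticalCorr 3 2 ![lat δ x 0, lat δ x 1] *
      criticalCorr 3 2 ![lat δ x 2, lat δ x 3]) ≤ - latU4 δ x := by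
  filter_upwards [hev] with δ hδ
  obtain ⟨hU, hT, hid⟩ := box_data δ x
  have hB := ((hT 0 1).mul (hT 2 3)).const_mul (2 * κ)
  refine le_of_tendsto_of_tendsto hB hU.neg ?_
  filter_upwards [hδ, hid, eventually_lat_mem_box δ x ∅] with L hL hidL hbox
  rw [hidL]
  have hG01 : 0 ≤ boxG L (lat δ x 0) (lat δ x 1) :=
    isingTwoPoint_free_nonneg' (criticalBeta_nonneg 3) (hbox.1 0) (hbox.1 1)
  have hG23 : 0 ≤ boxG L (lat δ x 2) (lat δ x 3) :=
    isingTwoPoint_free_nonneg' (criticalBeta_nonneg 3) (hbox.1 2) (hbox.1 3)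
  have hGG : 0 ≤ boxG L (lat δ x 0) (lat δ x 1) * boxG L (lat δ x 2) (lat δ x 3) := mul_nonneg hG01 hG23
  nlinarith [mul_le_mul_of_nonneg_left hL hGG]

/-- **A lattice ratio bound at `x` forces `U₄^S(x) < 0`** for every non-degenerate pointwise limit
(the rescaled inequality passes to the limit, `tendsto_rescaled_criticalUrsellFour`).
[cite: AizenmanDuminilCopinAnnals2021, eq. (3.11)] -/
theorem limitConnectedFour_neg_of_lattice_ratio {ρ : ℝ → ℝ} {S : CorrFamily 3}
    (hlim : HasPointwiseScalingLimit (criticalCorr 3) ρ S) (hnd : IsNondegenerateTwoPoint S)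
    {x : Fin 4 → EuclideanSpace ℝ (Fin 3)} (hx : x ∈ NonCoincident 3 4) {c : ℝ} (hc : 0 < c)
    (hev : ∀ᶠ δ in 𝓝[>] (0:ℝ), c * (criticalCorr 3 2 ![lat δ x 0, lat δ x 1] *
      criticalCorr 3 2 ![lat δ x 2, lat δ x 3]) ≤ - latU4 δ x) :
    limitConnectedFour S x < 0 := by
  have hinj : Function.Injective x := hx
  have hpair : ∀ i j, i ≠ j → Tendsto
      (fun δ => ρ δ ^ 2 * criticalCorr 3 2 ![lat δ x i, lat δ x j]) (𝓝[>] 0) (𝓝 (S 2 ![x i, x j])) := by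
    intro i j hij
    have hmem : (![x i, x j] : Fin 2 → EuclideanSpace ℝ (Fin 3)) ∈ NonCoincident 3 2 :=
      pair_mem_nonCoincident fun h => hij (hinj h)
    refine Tendsto.congr (fun δ => ?_) ((hlim 2).tendsto_at hmem)
    rw [rescaledCorrelator_apply, latticeApprox_comp_two]
    rfl
  have hU : Tendsto (fun δ => ρ δ ^ 4 * latU4 δ x) (𝓝[>] 0) (𝓝 (limitConnectedFour S x)) :=
    tendsto_rescaled_criticalUrsellFour hlim hx
  have hB := (((hpair 0 1 (by decide)).mul (hpair 2 3 (by decide))).const_mul c)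
  have hle : c * (S 2 ![x 0, x 1] * S 2 ![x 2, x 3]) ≤ - limitConnectedFour S x := by
    refine le_of_tendsto_of_tendsto hB hU.neg ?_
    filter_upwards [hev] with δ hδ
    have h4 : (0:ℝ) ≤ ρ δ ^ 4 := by positivity
    have := mul_le_mul_of_nonneg_left hδ h4
    calc c * (ρ δ ^ 2 * criticalCorr 3 2 ![lat δ x 0, lat δ x 1] *
          (ρ δ ^ 2 * criticalCorr 3 2 ![lat δ x 2, lat δ x 3]))
        = ρ δ ^ 4 * (c * (criticalCorr 3 2 ![lat δ x 0, lat δ x 1] *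
          criticalCorr 3 2 ![lat δ x 2, lat δ x 3])) := by ring
      _ ≤ ρ δ ^ 4 * (- latU4 δ x) := this
      _ = -(ρ δ ^ 4 * latU4 δ x) := by ring
  have h01 : (![x 0, x 1] : Fin 2 → _) ∈ NonCoincident 3 2 :=
    pair_mem_nonCoincident fun h => absurd (hinj h) (by decide)
  have h23 : (![x 2, x 3] : Fin 2 → _) ∈ NonCoincident 3 2 :=
    pair_mem_nonCoincident fun h => absurd (hinj h) (by decide)
  have hpos : 0 < c * (S 2 ![x 0, x 1] * S 2 ![x 2, x 3]) :=
    mul_pos hc (mul_pos (hnd _ h01) (hnd _ h23))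
  linarith

/-- **Conversely, `U₄^S(x) < 0` forces `P² ≥ κ > 0` at `[x/δ]`** for small `δ` and large `L`
(with `κ = p(x)/4`, `p = −U₄^S/(2S₂S₂)`). [cite: AizenmanDuminilCopinAnnals2021, eq. (3.11)] -/
theorem twoCurrentMeet_lower_of_limitConnectedFour_neg {ρ : ℝ → ℝ} {S : CorrFamily 3}
    (hρ : ∀ δ ∈ Set.Ioc (0:ℝ) 1, 0 < ρ δ) (hlim : HasPointwiseScalingLimit (criticalCorr 3) ρ S)
    (hnd : IsNondegenerateTwoPoint S) {x : Fin 4 → EuclideanSpace ℝ (Fin 3)} (hx : x ∈ NonCoincident 3 4)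
    (hneg : limitConnectedFour S x < 0) :
    ∃ κ : ℝ, 0 < κ ∧ ∀ᶠ δ in 𝓝[>] (0:ℝ), ∀ᶠ L : ℕ in atTop,
      κ ≤ twoCurrentMeet L (lat δ x 0) (lat δ x 1) (lat δ x 2) (lat δ x 3) := by
  have hinj : Function.Injective x := hx
  have hpair : ∀ i j, i ≠ j → Tendsto
      (fun δ => ρ δ ^ 2 * criticalCorr 3 2 ![lat δ x i, lat δ x j]) (𝓝[>] 0) (𝓝 (S 2 ![x i, x j])) := by
    intro i j hij
    have hmem : (![x i, x j] : Fin 2 → EuclideanSpace ℝ (Fin 3)) ∈ NonCoincident 3 2 :=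
      pair_mem_nonCoincident fun h => hij (hinj h)
    refine Tendsto.congr (fun δ => ?_) ((hlim 2).tendsto_at hmem)
    rw [rescaledCorrelator_apply, latticeApprox_comp_two]
    rfl
  set u : ℝ := - limitConnectedFour S x with hu
  set s : ℝ := S 2 ![x 0, x 1] * S 2 ![x 2, x 3] with hs
  have hu0 : 0 < u := by rw [hu]; linarith
  have h01 : (![x 0, x 1] : Fin 2 → _) ∈ NonCoincident 3 2 :=
    pair_mem_nonCoincident fun h => absurd (hinj h) (by decide)
  have h23 : (![x 2, x 3] : Fin 2 → _) ∈ NonCoincident 3 2 :=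
    pair_mem_nonCoincident fun h => absurd (hinj h) (by decide)
  have hs0 : 0 < s := mul_pos (hnd _ h01) (hnd _ h23)
  -- Step 1: the lattice ratio bound with constant `c = u/(2s)`
  set c : ℝ := u / (2 * s) with hc
  have hc0 : 0 < c := by positivity
  have hU : Tendsto (fun δ => -(ρ δ ^ 4 * latU4 δ x)) (𝓝[>] 0) (𝓝 u) :=
    (tendsto_rescaled_criticalUrsellFour hlim hx).neg
  have hB : Tendsto (fun δ => c * ((ρ δ ^ 2 * criticalCorr 3 2 ![lat δ x 0, lat δ x 1]) *
      (ρ δ ^ 2 * criticalCorr 3 2 ![lat δ x 2, lat δ x 3]))) (𝓝[>] 0) (𝓝 (c * s)) :=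
    ((hpair 0 1 (by decide)).mul (hpair 2 3 (by decide))).const_mul _
  have hmid : c * s < 3 * u / 4 := by
    rw [hc, div_mul_eq_mul_div, mul_comm 2 s, ← div_div, mul_div_assoc, div_self hs0.ne', mul_one]
    linarith
  have hmid' : 3 * u / 4 < u := by linarith
  have hIoc : Set.Ioc (0:ℝ) 1 ∈ 𝓝[>] (0:ℝ) := Ioc_mem_nhdsGT one_pos
  have hlat : ∀ᶠ δ in 𝓝[>] (0:ℝ), c * (criticalCorr 3 2 ![lat δ x 0, lat δ x 1] *
      criticalCorr 3 2 ![lat δ x 2, lat δ x 3]) < - latU4 δ x := by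
    filter_upwards [hB.eventually_lt_const hmid, hU.eventually_const_lt hmid',
      Filter.eventually_of_mem hIoc fun δ hδ => hδ] with δ h1 h2 hδ
    have hρ4 : 0 < ρ δ ^ 4 := pow_pos (hρ δ hδ) 4
    have key : ρ δ ^ 4 * (c * (criticalCorr 3 2 ![lat δ x 0, lat δ x 1] *
        criticalCorr 3 2 ![lat δ x 2, lat δ x 3])) < ρ δ ^ 4 * (- latU4 δ x) := by
      have e1 : ρ δ ^ 4 * (c * (criticalCorr 3 2 ![lat δ x 0, lat δ x 1] *
          criticalCorr 3 2 ![lat δ x 2, lat δ x 3])) =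
          c * ((ρ δ ^ 2 * criticalCorr 3 2 ![lat δ x 0, lat δ x 1]) *
            (ρ δ ^ 2 * criticalCorr 3 2 ![lat δ x 2, lat δ x 3])) := by ring
      have e2 : ρ δ ^ 4 * (- latU4 δ x) = -(ρ δ ^ 4 * latU4 δ x) := by ring
      rw [e1, e2]
      linarith
    exact lt_of_mul_lt_mul_left key hρ4.le
  -- Step 2: in the box, `P² = -U₄,Λ / (2 G_L G_L) → -U₄^{lat}/(2GG) > c/2`
  refine ⟨c / 4, by positivity, ?_⟩
  filter_upwards [hlat] with δ hδ
  obtain ⟨hUL, hT, hid⟩ := box_data δ x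
  set g01 := criticalCorr 3 2 ![lat δ x 0, lat δ x 1] with hg01
  set g23 := criticalCorr 3 2 ![lat δ x 2, lat δ x 3] with hg23
  have hpos01 : 0 < g01 := criticalCorr_two_pos' _ _
  have hpos23 : 0 < g23 := criticalCorr_two_pos' _ _
  have hPev : ∀ᶠ L : ℕ in atTop, twoCurrentMeet L (lat δ x 0) (lat δ x 1) (lat δ x 2) (lat δ x 3) =
      -(connectedFour (isingMeasure (zdGraph 3) (box 3 L) (criticalBeta 3) 0 .free) spinAt
        (fun i => lat δ x i)) / (2 * (boxG L (lat δ x 0) (lat δ x 1) * boxG L (lat δ x 2) (lat δ x 3))) := by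
    filter_upwards [hid, (hT 0 1).eventually_const_lt hpos01, (hT 2 3).eventually_const_lt hpos23]
      with L hidL h01 h23
    rw [hidL]
    field_simp
  have hlimP : Tendsto (fun L : ℕ => -(connectedFour (isingMeasure (zdGraph 3) (box 3 L) (criticalBeta 3) 0
      .free) spinAt (fun i => lat δ x i)) / (2 * (boxG L (lat δ x 0) (lat δ x 1) *
        boxG L (lat δ x 2) (lat δ x 3)))) atTop (𝓝 (-(latU4 δ x) / (2 * (g01 * g23)))) :=
    hUL.neg.div (((hT 0 1).mul (hT 2 3)).const_mul 2) (by positivity)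
  have htarget : c / 4 < -(latU4 δ x) / (2 * (g01 * g23)) := by
    rw [lt_div_iff₀ (by positivity)]
    nlinarith [hδ, mul_pos hpos01 hpos23]
  filter_upwards [hPev, hlimP.eventually_const_lt htarget] with L hPL hlt
  rw [hPL]
  exact hlt.le

/-- **Aizenman's criterion, per limit (sufficiency):** if at ONE non-coincident quadruple the box
double-current gluing probability `P²` at `[x/δ]` stays `≥ κ > 0` for small `δ` and large `L`, then EVERY
non-degenerate pointwise limit `S` of `criticalCorr 3` (any `ρ`) has `U₄^S(x) < 0`, hence
`HasNontrivialU4 S`. [cite: Aizenman1982, §1] -/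
theorem hasNontrivialU4_of_twoCurrentMeet_lower {ρ : ℝ → ℝ} {S : CorrFamily 3}
    (hlim : HasPointwiseScalingLimit (criticalCorr 3) ρ S) (hnd : IsNondegenerateTwoPoint S)
    {x : Fin 4 → EuclideanSpace ℝ (Fin 3)} (hx : x ∈ NonCoincident 3 4) {κ : ℝ} (hκ : 0 < κ)
    (hev : ∀ᶠ δ in 𝓝[>] (0:ℝ), ∀ᶠ L : ℕ in atTop,
      κ ≤ twoCurrentMeet L (lat δ x 0) (lat δ x 1) (lat δ x 2) (lat δ x 3)) :
    HasNontrivialU4 S :=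
  ⟨x, hx, (limitConnectedFour_neg_of_lattice_ratio hlim hnd hx (by positivity : 0 < 2 * κ)
    (lattice_ratio_of_twoCurrentMeet_lower hev)).ne⟩

/-- **Aizenman's criterion, per limit (necessity):** a non-degenerate pointwise limit with `U₄ ≢ 0`
(`ρ > 0` on `(0,1]`) has a quadruple where `P² ≥ κ > 0` at `[x/δ]` for small `δ` and large `L`.
[cite: Aizenman1982, §1] -/
theorem twoCurrentMeet_lower_of_hasNontrivialU4 {ρ : ℝ → ℝ} {S : CorrFamily 3}
    (hρ : ∀ δ ∈ Set.Ioc (0:ℝ) 1, 0 < ρ δ) (hlim : HasPointwiseScalingLimit (criticalCorr 3) ρ S)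
    (hnd : IsNondegenerateTwoPoint S) (hU : HasNontrivialU4 S) :
    ∃ x ∈ NonCoincident 3 4, ∃ κ : ℝ, 0 < κ ∧ ∀ᶠ δ in 𝓝[>] (0:ℝ), ∀ᶠ L : ℕ in atTop,
      κ ≤ twoCurrentMeet L (lat δ x 0) (lat δ x 1) (lat δ x 2) (lat δ x 3) := by
  obtain ⟨x, hx, hneg⟩ := (hasNontrivialU4_iff_exists_neg_of_hasPointwiseScalingLimit le_rfl hlim).1 hU
  exact ⟨x, hx, twoCurrentMeet_lower_of_limitConnectedFour_neg hρ hlim hnd hx hneg⟩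

/-! ## The calibration: meeting robustness IS the crux's conclusion (given the fat step) -/

/-- **MEETING ROBUSTNESS ⟺ `U₄ ≢ 0`, kernel-checked.** For a non-degenerate pointwise scaling limit `S`
of `criticalCorr 3` (`ρ > 0` on `(0,1]`), scale covariant on non-coincident configurations with exponent
`Δ < 3/4`: the thin step of the line (`∃ x ∈ NC₄, ∃ c > 0`, `c·P⁴ ≤ P²` at `[x/δ]` for small `δ`, large
`L`) holds iff `HasNontrivialU4 S`. With the fat step a theorem, the registered stub
`stub_meetingRobustness` is therefore EXACTLY as strong as the crux restricted to that limit: it is the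
crux in random-current clothing, not a weakening of it. [cite: AizenmanDuminilCopinAnnals2021, eq. (3.11) and Lemma 4.4] -/
theorem meetingRobustness_iff_hasNontrivialU4 {ρ : ℝ → ℝ} {S : CorrFamily 3} {Δ : ℝ}
    (hρ : ∀ δ ∈ Set.Ioc (0:ℝ) 1, 0 < ρ δ) (hlim : HasPointwiseScalingLimit (criticalCorr 3) ρ S)
    (hnd : IsNondegenerateTwoPoint S) (hcov : ScaleCovariantOn Δ S) (hΔ : Δ < 3 / 4) :
    (∃ x ∈ NonCoincident 3 4, ∃ c : ℝ, 0 < c ∧ ∀ᶠ δ in 𝓝[>] (0:ℝ), ∀ᶠ L : ℕ in atTop,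
        c * fourCurrentMeet L (lat δ x 0) (lat δ x 1) (lat δ x 2) (lat δ x 3) ≤
          twoCurrentMeet L (lat δ x 0) (lat δ x 1) (lat δ x 2) (lat δ x 3)) ↔
      HasNontrivialU4 S := by
  constructor
  · rintro ⟨x, hx, c, hc, hev⟩
    obtain ⟨c', hc', hev'⟩ := stub_fatStep ρ S Δ hρ hlim hnd hcov hΔ x hx
    refine hasNontrivialU4_of_twoCurrentMeet_lower hlim hnd hx (mul_pos hc hc') ?_
    filter_upwards [hev, hev'] with δ hδ hδ'
    filter_upwards [hδ, hδ'] with L hL hL'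
    exact (mul_le_mul_of_nonneg_left hL' hc.le).trans hL
  · intro hU
    obtain ⟨x, hx, κ, hκ, hev⟩ := twoCurrentMeet_lower_of_hasNontrivialU4 hρ hlim hnd hU
    refine ⟨x, hx, κ, hκ, ?_⟩
    filter_upwards [hev] with δ hδ
    filter_upwards [hδ] with L hL
    calc κ * fourCurrentMeet L (lat δ x 0) (lat δ x 1) (lat δ x 2) (lat δ x 3) ≤ κ * 1 :=
          mul_le_mul_of_nonneg_left (fourCurrentMeet_le_one L _ _ _ _) hκ.le
      _ = κ := mul_one κ
      _ ≤ _ := hL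

end Summit.CriticalPhenomena.Ising3DConformalLimit.Cruxes.IsingEuclidUpgradeR4NonGaussian.FreeCovarianceDeltaDichotomy

end
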